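import Literature.Probability.Percolation.CriticalProbOrientedBound
import Literature.Probability.Percolation.OrientedWalkSuccessors
import HarnessLib

/-!
# Shielded oriented paths: the edges adjacent to an oriented path and the bound (3.4)

Topic `Literature/Probability/Percolation`.  Sorry-free, no named facts.  Combinatorial core of the
proof of Theorem 1.2 of Bock–Damron–Newman–Sidoravicius, *Percolation of finite clusters and
shielded paths*, J. Stat. Phys. 179 (2020), §3 (pp. 5–7): for an oriented path `γ` of `w` with
vertices `x_0 = 0, …, x_n` let `𝓔(γ)` be the set of lattice edges with an endpoint in `γ`
(`γ` is SHIELDED iff all of `𝓔(γ)` is closed).  Then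

* `card_adjEdges`: `#𝓔(γ) = 2d + n(2d - 1)` (BDNS (3.2): `E N_n = q^{2d}(d q^{2d-1})^n`);
* `card_adjEdges_inter_le`, the bound (3.4) of the paper:
  `#(𝓔(γ) ∩ 𝓔(γ')) ≤ 2d + (2d - 1) #Z_n(γ,γ') + #O_n(γ,γ')` with
  `Z_n = {1 ≤ k ≤ n : x_k = x'_k}` (`zCount`) and `O_n = {1 ≤ k ≤ n : ‖x_k - x'_k‖₁ = 2}` (`oCount`,
  via `IsS2`);
* `mem_adjEdges_of_adj` (every lattice edge at a vertex of `γ` lies in `𝓔(γ)`) and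
  `adjEdges_subset_edgeSet`.

## Proof of (3.4) (a reorganisation of BDNS pp. 6–7 by levels)

Edges are sorted by the level of their lower endpoint (`lowLevel`): `𝓔(γ)` is the disjoint union of
the `d` edges below the origin, the layers `L_m = up(x_m) ∪ down(x_{m+1})` (`0 ≤ m < n`, `2d - 1`
edges each, the two halves sharing the path edge) and the `d` edges above `x_n` (`adjPiece`,
`adjEdges`).  Common edges of `γ, γ'` lie in common pieces, and layer by layer
(`card_layer_inter_le`) `#(L_m ∩ L'_m) ≤ (d-1)·1[x_m = x'_m] + d·1[x_{m+1} = x'_{m+1}] + 1[‖x_{m+1} - x'_{m+1}‖₁ = 2]`: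
the four cases are BDNS's (3.6) (coincident stretches) and the injection `i` of (3.7) (at most ONE
of the two "cross" edges `{x_m, x'_{m+1}}`, `{x'_m, x_{m+1}}` exists, step (a), and it forces
`‖x_{m+1} - x'_{m+1}‖₁ = 2`, step (b)).  Summing over `m` gives (3.4).

## References

* B. Bock, M. Damron, C. M. Newman, V. Sidoravicius, J. Stat. Phys. 179 (2020) 789–807,
  arXiv:1811.01678, §3, (3.2)–(3.7). [BockEtAl2020]
-/

namespace Literature.Probability.Percolation

open Finset Literature.Probability.LatticeModels

variable {d : ℕ}

/-! ### Unit vectors -/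

/-- `e_j = e_b ↔ j = b`. [folklore] -/
theorem single_eq_single_iff {j b : Fin d} :
    (Pi.single j (1 : ℤ) : Site d) = Pi.single b 1 ↔ j = b := by
  rw [← sub_eq_zero, single_sub_single_eq_zero_iff]

/-- `e_i + e_j = e_a + e_b ↔ {i, j} = {a, b}` (as multisets). [folklore] -/
theorem single_add_single_eq_iff {i j a b : Fin d} :
    (Pi.single i (1 : ℤ) : Site d) + Pi.single j 1 = Pi.single a 1 + Pi.single b 1 ↔
      (i = a ∧ j = b) ∨ (i = b ∧ j = a) := by
  constructor
  · intro h
    have hi := congrArg (massOn {i}) h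
    simp only [massOn_add, massOn_single, Finset.mem_singleton, if_true] at hi
    by_cases hai : a = i
    · subst hai
      refine Or.inl ⟨rfl, single_eq_single_iff.1 (add_left_cancel h)⟩
    · by_cases hbi : b = i
      · subst hbi
        rw [add_comm (Pi.single a 1)] at h
        exact Or.inr ⟨rfl, single_eq_single_iff.1 (add_left_cancel h)⟩
      · exfalso
        rw [if_neg hai, if_neg hbi] at hi
        split_ifs at hi <;> omega
  · rintro (⟨rfl, rfl⟩ | ⟨rfl, rfl⟩)
    · rfl
    · exact add_comm _ _

/-- Levels of neighbours. [folklore] -/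
theorem level_add_single (u : Site d) (i : Fin d) : level (u + Pi.single i 1) = level u + 1 := by
  rw [level_add, level_single]

/-- Levels of neighbours. [folklore] -/
theorem level_sub_single (u : Site d) (i : Fin d) : level (u - Pi.single i 1) = level u - 1 := by
  rw [level_sub, level_single]

/-! ### Up and down edges at a site -/

/-- The `d` edges `{u, u + e_i}` above `u`. [cite: BockEtAl2020, §3 (proof of Thm 1.2)] -/
def upEdges (u : Site d) : Finset (Sym2 (Site d)) :=
  univ.image fun i : Fin d => s(u, u + Pi.single i 1)

/-- The `d` edges `{u - e_i, u}` below `u`. [cite: BockEtAl2020, §3 (proof of Thm 1.2)] -/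
def downEdges (u : Site d) : Finset (Sym2 (Site d)) :=
  univ.image fun i : Fin d => s(u - Pi.single i 1, u)

/-- Membership in `upEdges`. [folklore] -/
theorem mem_upEdges {u : Site d} {e : Sym2 (Site d)} :
    e ∈ upEdges u ↔ ∃ i : Fin d, e = s(u, u + Pi.single i 1) := by
  simp [upEdges, eq_comm]

/-- Membership in `downEdges`. [folklore] -/
theorem mem_downEdges {u : Site d} {e : Sym2 (Site d)} :
    e ∈ downEdges u ↔ ∃ i : Fin d, e = s(u - Pi.single i 1, u) := by
  simp [downEdges, eq_comm]

/-- An up edge determines its lower endpoint (and its direction). [folklore] -/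
theorem upEdge_eq_upEdge {u v : Site d} {i j : Fin d}
    (h : s(u, u + Pi.single i (1 : ℤ)) = s(v, v + Pi.single j 1)) : u = v ∧ i = j := by
  rcases Sym2.eq_iff.1 h with ⟨h1, h2⟩ | ⟨h1, h2⟩
  · subst h1
    exact ⟨rfl, single_eq_single_iff.1 (add_left_cancel h2)⟩
  · exfalso
    have e1 := congrArg level h1
    have e2 := congrArg level h2
    rw [level_add_single] at e1 e2
    linarith

/-- A down edge determines its upper endpoint (and its direction). [folklore] -/
theorem downEdge_eq_downEdge {u v : Site d} {i j : Fin d}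
    (h : s(u - Pi.single i (1 : ℤ), u) = s(v - Pi.single j 1, v)) : u = v ∧ i = j := by
  rcases Sym2.eq_iff.1 h with ⟨h1, h2⟩ | ⟨h1, h2⟩
  · subst h2
    have : (Pi.single i (1 : ℤ) : Site d) = Pi.single j 1 := by
      have := h1
      rw [sub_eq_sub_iff_add_eq_add] at this
      linear_combination -this
    exact ⟨rfl, single_eq_single_iff.1 this⟩
  · exfalso
    have e1 := congrArg level h1
    have e2 := congrArg level h2
    rw [level_sub_single] at e1 e2
    linarith

/-- An edge which is up at `u` and down at `v` is the edge `{u, v}`, `v = u + e_i`. [folklore] -/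
theorem upEdge_eq_downEdge {u v : Site d} {i j : Fin d}
    (h : s(u, u + Pi.single i (1 : ℤ)) = s(v - Pi.single j 1, v)) : v = u + Pi.single i 1 := by
  rcases Sym2.eq_iff.1 h with ⟨-, h2⟩ | ⟨h1, h2⟩
  · exact h2.symm
  · exfalso
    have e1 := congrArg level h1
    have e2 := congrArg level h2
    rw [level_add_single, level_sub_single] at e2
    linarith

/-- `#up(u) = d`. [cite: BockEtAl2020, §3 (3.2)] -/
theorem card_upEdges (u : Site d) : (upEdges u).card = d := by
  rw [upEdges, Finset.card_image_of_injective, Finset.card_univ, Fintype.card_fin]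
  intro i j h
  exact (upEdge_eq_upEdge h).2

/-- `#down(u) = d`. [cite: BockEtAl2020, §3 (3.2)] -/
theorem card_downEdges (u : Site d) : (downEdges u).card = d := by
  rw [downEdges, Finset.card_image_of_injective, Finset.card_univ, Fintype.card_fin]
  intro i j h
  exact (downEdge_eq_downEdge h).2

/-- Up edges at distinct sites are distinct. [folklore] -/
theorem upEdges_inter_upEdges_eq_empty {u v : Site d} (h : u ≠ v) : upEdges u ∩ upEdges v = ∅ := by
  refine Finset.eq_empty_of_forall_notMem fun e he => ?_
  rw [Finset.mem_inter, mem_upEdges, mem_upEdges] at he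
  obtain ⟨⟨i, rfl⟩, ⟨j, hj⟩⟩ := he
  exact h (upEdge_eq_upEdge hj).1

/-- Down edges at distinct sites are distinct. [folklore] -/
theorem downEdges_inter_downEdges_eq_empty {u v : Site d} (h : u ≠ v) :
    downEdges u ∩ downEdges v = ∅ := by
  refine Finset.eq_empty_of_forall_notMem fun e he => ?_
  rw [Finset.mem_inter, mem_downEdges, mem_downEdges] at he
  obtain ⟨⟨i, rfl⟩, ⟨j, hj⟩⟩ := he
  exact h (downEdge_eq_downEdge hj).1

/-- `up(u) ∩ down(v) ⊆ {{u, v}}`. [folklore] -/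
theorem upEdges_inter_downEdges_subset (u v : Site d) : upEdges u ∩ downEdges v ⊆ {s(u, v)} := by
  intro e he
  rw [Finset.mem_inter, mem_upEdges, mem_downEdges] at he
  obtain ⟨⟨i, rfl⟩, ⟨j, hj⟩⟩ := he
  rw [Finset.mem_singleton, upEdge_eq_downEdge hj]

/-- If `up(u) ∩ down(v)` is nonempty then `v = u + e_i` for some `i`. [folklore] -/
theorem exists_eq_add_single_of_mem_inter {u v : Site d} {e : Sym2 (Site d)}
    (he : e ∈ upEdges u ∩ downEdges v) : ∃ i : Fin d, v = u + Pi.single i 1 := by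
  rw [Finset.mem_inter, mem_upEdges, mem_downEdges] at he
  obtain ⟨⟨i, rfl⟩, ⟨j, hj⟩⟩ := he
  exact ⟨i, upEdge_eq_downEdge hj⟩

/-- The up edges at `u` and the down edges at `u + e_a` share exactly the edge `{u, u + e_a}`.
[cite: BockEtAl2020, §3 (3.2)] -/
theorem upEdges_inter_downEdges_step (u : Site d) (a : Fin d) :
    upEdges u ∩ downEdges (u + Pi.single a 1) = {s(u, u + Pi.single a 1)} := by
  refine Finset.Subset.antisymm (upEdges_inter_downEdges_subset _ _) ?_
  rw [Finset.singleton_subset_iff, Finset.mem_inter, mem_upEdges, mem_downEdges]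
  exact ⟨⟨a, rfl⟩, ⟨a, by rw [add_sub_cancel_right]⟩⟩

/-! ### The level of the lower endpoint -/

/-- The level of the lower endpoint of an edge. [folklore] -/
def lowLevel : Sym2 (Site d) → ℤ :=
  Sym2.lift ⟨fun u v => min (level u) (level v), fun _ _ => min_comm _ _⟩

/-- `lowLevel {u, v} = min (level u) (level v)`. [folklore] -/
@[simp] theorem lowLevel_mk (u v : Site d) : lowLevel s(u, v) = min (level u) (level v) := rfl

/-- Up edges at `u` have lower level `level u`. [folklore] -/
theorem lowLevel_of_mem_upEdges {u : Site d} {e : Sym2 (Site d)} (he : e ∈ upEdges u) :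
    lowLevel e = level u := by
  obtain ⟨i, rfl⟩ := mem_upEdges.1 he
  rw [lowLevel_mk, level_add_single, min_eq_left (by linarith)]

/-- Down edges at `u` have lower level `level u - 1`. [folklore] -/
theorem lowLevel_of_mem_downEdges {u : Site d} {e : Sym2 (Site d)} (he : e ∈ downEdges u) :
    lowLevel e = level u - 1 := by
  obtain ⟨i, rfl⟩ := mem_downEdges.1 he
  rw [lowLevel_mk, level_sub_single, min_eq_left (by linarith)]

/-! ### The edges adjacent to an oriented path -/

variable {n : ℕ}

/-- `#(up(x) ∪ down(x + e_a)) = 2d - 1` (the two halves share the edge `{x, x + e_a}`).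
[cite: BockEtAl2020, §3 (3.2)] -/
theorem card_upEdges_union_downEdges (x : Site d) (a : Fin d) :
    (upEdges x ∪ downEdges (x + Pi.single a 1)).card = 2 * d - 1 := by
  have h := Finset.card_union_add_card_inter (upEdges x) (downEdges (x + Pi.single a 1))
  rw [card_upEdges, card_downEdges, upEdges_inter_downEdges_step, Finset.card_singleton] at h
  omega

/-- The layer of edges with lower level `m`: up at `x_m` or down at `x_{m+1}`.
[cite: BockEtAl2020, §3 (proof of Thm 1.2)] -/
def layer (w : Fin n → Fin d) (m : ℕ) : Finset (Sym2 (Site d)) :=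
  upEdges (opos w m) ∪ downEdges (opos w (m + 1))

/-- The pieces of `𝓔(γ)` by lower level `t - 1`: the edges below the origin (`t = 0`), the layers
(`1 ≤ t ≤ n`) and the edges above `x_n` (`t = n + 1`). [cite: BockEtAl2020, §3 (proof of Thm 1.2)] -/
def adjPiece (w : Fin n → Fin d) (t : ℕ) : Finset (Sym2 (Site d)) :=
  if t = 0 then downEdges 0 else if t ≤ n then layer w (t - 1) else upEdges (opos w n)

/-- `𝓔(γ)`: the set of lattice edges with an endpoint on the oriented path of `w`
("the set of edges adjacent to `γ`"). [cite: BockEtAl2020, §3 (proof of Thm 1.2)] -/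
def adjEdges (w : Fin n → Fin d) : Finset (Sym2 (Site d)) :=
  (range (n + 1 + 1)).biUnion (adjPiece w)

/-- A layer has `2d - 1` edges. [cite: BockEtAl2020, §3 (3.2)] -/
theorem card_layer (w : Fin n → Fin d) {m : ℕ} (hm : m < n) : (layer w m).card = 2 * d - 1 := by
  rw [layer, opos_succ w hm]
  exact card_upEdges_union_downEdges _ _

/-- Edges in `adjPiece w t` have lower level `t - 1` (`t ≤ n + 1`). [folklore] -/
theorem lowLevel_of_mem_piece (w : Fin n → Fin d) {t : ℕ} (ht : t ≤ n + 1) {e : Sym2 (Site d)}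
    (he : e ∈ adjPiece w t) : lowLevel e = (t : ℤ) - 1 := by
  unfold adjPiece at he
  split_ifs at he with h0 h1
  · rw [lowLevel_of_mem_downEdges he, h0, level_zero]
    norm_num
  · rw [layer, Finset.mem_union] at he
    rcases he with he | he
    · rw [lowLevel_of_mem_upEdges he, level_opos w (by omega)]
      omega
    · rw [lowLevel_of_mem_downEdges he, level_opos w (by omega)]
      omega
  · rw [lowLevel_of_mem_upEdges he, level_opos w le_rfl]
    omega

/-- Distinct pieces are disjoint. [folklore] -/
theorem disjoint_piece (w w' : Fin n → Fin d) {t t' : ℕ} (ht : t ≤ n + 1) (ht' : t' ≤ n + 1)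
    (htt : t ≠ t') : Disjoint (adjPiece w t) (adjPiece w' t') := by
  rw [Finset.disjoint_left]
  intro e he he'
  have h1 := lowLevel_of_mem_piece w ht he
  have h2 := lowLevel_of_mem_piece w' ht' he'
  omega

/-- **BDNS (3.2)**: `#𝓔(γ) = 2d + n(2d - 1)` ("the probability that any `γ` is shielded is
`q^{2d}(q^{2d-1})^n`"). [cite: BockEtAl2020, §3 (3.2)] -/
theorem card_adjEdges (w : Fin n → Fin d) : (adjEdges w).card = 2 * d + n * (2 * d - 1) := by
  have hdisj : ((range (n + 1 + 1) : Finset ℕ) : Set ℕ).PairwiseDisjoint (adjPiece w) := by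
    intro t ht t' ht' htt
    have h1 := Finset.mem_range.1 (Finset.mem_coe.1 ht)
    have h2 := Finset.mem_range.1 (Finset.mem_coe.1 ht')
    exact disjoint_piece w w (by omega) (by omega) htt
  rw [adjEdges, Finset.card_biUnion hdisj, Finset.sum_range_succ, Finset.sum_range_succ']
  have hmid : ∀ t ∈ range n, (adjPiece w (t + 1)).card = 2 * d - 1 := by
    intro t ht
    rw [Finset.mem_range] at ht
    rw [adjPiece, if_neg (Nat.succ_ne_zero t), if_pos (by omega), Nat.add_sub_cancel]
    exact card_layer w ht
  rw [Finset.sum_congr rfl hmid, Finset.sum_const, Finset.card_range, smul_eq_mul]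
  rw [adjPiece, if_pos rfl, card_downEdges, adjPiece, if_neg (Nat.succ_ne_zero n), if_neg (by omega),
    card_upEdges]
  ring

/-- Up edges at `x_k` belong to `𝓔(γ)`. [cite: BockEtAl2020, §3] -/
theorem upEdges_subset_adjEdges (w : Fin n → Fin d) {k : ℕ} (hk : k ≤ n) :
    upEdges (opos w k) ⊆ adjEdges w := by
  intro e he
  rw [adjEdges, Finset.mem_biUnion]
  rcases Nat.lt_or_ge k n with hlt | hge
  · refine ⟨k + 1, Finset.mem_range.2 (by omega), ?_⟩
    rw [adjPiece, if_neg (Nat.succ_ne_zero k), if_pos (by omega), Nat.add_sub_cancel, layer]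
    exact Finset.mem_union_left _ he
  · have hkn : k = n := le_antisymm hk hge
    subst hkn
    refine ⟨k + 1, Finset.mem_range.2 (by omega), ?_⟩
    rw [adjPiece, if_neg (Nat.succ_ne_zero k), if_neg (by omega)]
    exact he

/-- Down edges at `x_k` belong to `𝓔(γ)`. [cite: BockEtAl2020, §3] -/
theorem downEdges_subset_adjEdges (w : Fin n → Fin d) {k : ℕ} (hk : k ≤ n) :
    downEdges (opos w k) ⊆ adjEdges w := by
  intro e he
  rw [adjEdges, Finset.mem_biUnion]
  rcases Nat.eq_zero_or_pos k with rfl | hpos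
  · refine ⟨0, Finset.mem_range.2 (by omega), ?_⟩
    rw [adjPiece, if_pos rfl, ← opos_zero w]
    exact he
  · refine ⟨k, Finset.mem_range.2 (by omega), ?_⟩
    rw [adjPiece, if_neg (by omega), if_pos hk, layer, Nat.sub_add_cancel hpos]
    exact Finset.mem_union_right _ he

/-- **Every lattice edge at a vertex of `γ` lies in `𝓔(γ)`** (so "`𝓔(γ)` closed" means "`γ`
shielded"). [cite: BockEtAl2020, §3 (proof of Thm 1.2)] -/
theorem mem_adjEdges_of_adj (w : Fin n → Fin d) {k : ℕ} (hk : k ≤ n) {y : Site d}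
    (h : (zdGraph d).Adj (opos w k) y) : s(opos w k, y) ∈ adjEdges w := by
  rcases (zdGraph_adj_iff _ _).1 h with ⟨i, hy | hy⟩
  · rw [hy]
    exact upEdges_subset_adjEdges w hk (mem_upEdges.2 ⟨i, rfl⟩)
  · have : s(opos w k, y) = s(opos w k - Pi.single i 1, opos w k) := by
      rw [Sym2.eq_swap, hy, add_sub_cancel_right]
    rw [this]
    exact downEdges_subset_adjEdges w hk (mem_downEdges.2 ⟨i, rfl⟩)

/-- `𝓔(γ) ⊆ E(𝕃^d)`. [folklore] -/
theorem adjEdges_subset_edgeSet (w : Fin n → Fin d) :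
    (↑(adjEdges w) : Set (Sym2 (Site d))) ⊆ (zdGraph d).edgeSet := by
  intro e he
  rw [Finset.mem_coe, adjEdges, Finset.mem_biUnion] at he
  obtain ⟨t, -, he⟩ := he
  have hup : ∀ u : Site d, e ∈ upEdges u → e ∈ (zdGraph d).edgeSet := by
    intro u hu
    obtain ⟨i, rfl⟩ := mem_upEdges.1 hu
    rw [SimpleGraph.mem_edgeSet, zdGraph_adj_iff]
    exact ⟨i, Or.inl rfl⟩
  have hdown : ∀ u : Site d, e ∈ downEdges u → e ∈ (zdGraph d).edgeSet := by
    intro u hu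
    obtain ⟨i, rfl⟩ := mem_downEdges.1 hu
    rw [SimpleGraph.mem_edgeSet, zdGraph_adj_iff]
    exact ⟨i, Or.inl (by rw [sub_add_cancel])⟩
  unfold adjPiece at he
  split_ifs at he
  · exact hdown _ he
  · rw [layer, Finset.mem_union] at he
    rcases he with he | he
    · exact hup _ he
    · exact hdown _ he
  · exact hup _ he

/-! ### Common edges of two oriented paths: the bound (3.4) -/

/-- Decidability of membership in `S₂`. [folklore] -/
instance IsS2.instDecidable (v : Site d) : Decidable (IsS2 v) := by
  unfold IsS2
  infer_instance

/-- **The layer-by-layer bound** (BDNS (3.6)–(3.7) reorganised by levels): for the layers of two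
paths through `x, x + e_a` and `x', x' + e_{a'}`,
`#(L ∩ L') ≤ (d-1)·1[x = x'] + d·1[x + e_a = x' + e_{a'}] + 1[‖(x'+e_{a'}) - (x+e_a)‖₁ = 2]`.
[cite: BockEtAl2020, §3 (3.6)–(3.7)] -/
theorem card_cross_le (x x' : Site d) (a a' : Fin d) :
    ((upEdges x ∪ downEdges (x + Pi.single a 1)) ∩
        (upEdges x' ∪ downEdges (x' + Pi.single a' 1))).card ≤
      (d - 1) * (if x = x' then 1 else 0) +
        d * (if x + Pi.single a 1 = x' + Pi.single a' 1 then 1 else 0) +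
          (if IsS2 (x' + Pi.single a' 1 - (x + Pi.single a 1)) then 1 else 0) := by
  by_cases hyy : x + Pi.single a 1 = x' + Pi.single a' 1
  · -- `x_{m+1} = x'_{m+1}`
    rw [if_pos hyy]
    by_cases hxx : x = x'
    · -- both coincide: the layers are equal
      rw [if_pos hxx]
      calc ((upEdges x ∪ downEdges (x + Pi.single a 1)) ∩
              (upEdges x' ∪ downEdges (x' + Pi.single a' 1))).card
          ≤ (upEdges x ∪ downEdges (x + Pi.single a 1)).card :=
            Finset.card_le_card Finset.inter_subset_left
        _ = 2 * d - 1 := card_upEdges_union_downEdges x a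
        _ ≤ _ := by omega
    · -- only the tops coincide: common edges are down edges at the common top
      rw [if_neg hxx]
      calc ((upEdges x ∪ downEdges (x + Pi.single a 1)) ∩
              (upEdges x' ∪ downEdges (x' + Pi.single a' 1))).card
          ≤ (downEdges (x' + Pi.single a' 1)).card := by
            refine Finset.card_le_card fun e he => ?_
            rw [Finset.mem_inter, Finset.mem_union, Finset.mem_union] at he
            rcases he with ⟨h1 | h1, h2 | h2⟩
            · exfalso
              have := Finset.mem_inter.2 ⟨h1, h2⟩
              rw [upEdges_inter_upEdges_eq_empty hxx] at this
              exact Finset.notMem_empty e this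
            · exact h2
            · rw [hyy] at h1
              exact h1
            · exact h2
        _ = d := card_downEdges _
        _ ≤ _ := by omega
  · -- `x_{m+1} ≠ x'_{m+1}`
    rw [if_neg hyy]
    by_cases hxx : x = x'
    · -- only the bottoms coincide: common edges are up edges at the common bottom, and
      -- `x'_{m+1} - x_{m+1} = e_{a'} - e_a` has norm 2
      subst hxx
      rw [if_pos rfl]
      have haa : a' ≠ a := fun h => hyy (by rw [h])
      have hS : IsS2 (x + Pi.single a' 1 - (x + Pi.single a 1)) := ⟨a', a, haa, by abel⟩
      rw [if_pos hS]
      calc ((upEdges x ∪ downEdges (x + Pi.single a 1)) ∩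
              (upEdges x ∪ downEdges (x + Pi.single a' 1))).card
          ≤ (upEdges x).card := by
            refine Finset.card_le_card fun e he => ?_
            rw [Finset.mem_inter, Finset.mem_union, Finset.mem_union] at he
            rcases he with ⟨h1 | h1, h2 | h2⟩
            · exact h1
            · exact h1
            · exact h2
            · exfalso
              have := Finset.mem_inter.2 ⟨h1, h2⟩
              rw [downEdges_inter_downEdges_eq_empty hyy] at this
              exact Finset.notMem_empty e this
        _ = d := card_upEdges _
        _ ≤ _ := by omega
    · -- nothing coincides: at most one "cross" edge, and it forces norm 2
      rw [if_neg hxx]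
      have hsub : (upEdges x ∪ downEdges (x + Pi.single a 1)) ∩
          (upEdges x' ∪ downEdges (x' + Pi.single a' 1)) ⊆
          (upEdges x ∩ downEdges (x' + Pi.single a' 1)) ∪
            (downEdges (x + Pi.single a 1) ∩ upEdges x') := by
        intro e he
        rw [Finset.mem_inter, Finset.mem_union, Finset.mem_union] at he
        rw [Finset.mem_union, Finset.mem_inter, Finset.mem_inter]
        rcases he with ⟨h1 | h1, h2 | h2⟩
        · exfalso
          have := Finset.mem_inter.2 ⟨h1, h2⟩
          rw [upEdges_inter_upEdges_eq_empty hxx] at this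
          exact Finset.notMem_empty e this
        · exact Or.inl ⟨h1, h2⟩
        · exact Or.inr ⟨h1, h2⟩
        · exfalso
          have := Finset.mem_inter.2 ⟨h1, h2⟩
          rw [downEdges_inter_downEdges_eq_empty hyy] at this
          exact Finset.notMem_empty e this
      refine (Finset.card_le_card hsub).trans ?_
      -- the two cross sets are not both nonempty (BDNS (3.7), step (a))
      have hnotboth : ∀ e₁ ∈ upEdges x ∩ downEdges (x' + Pi.single a' 1),
          ∀ e₂ ∈ downEdges (x + Pi.single a 1) ∩ upEdges x', False := by
        intro e₁ he₁ e₂ he₂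
        obtain ⟨i, hi⟩ := exists_eq_add_single_of_mem_inter he₁
        rw [Finset.inter_comm] at he₂
        obtain ⟨j, hj⟩ := exists_eq_add_single_of_mem_inter he₂
        -- `e_i + e_j = e_{a'} + e_a`
        have hsum : (Pi.single i (1 : ℤ) : Site d) + Pi.single j 1 =
            Pi.single a' 1 + Pi.single a 1 := by
          linear_combination -hi - hj
        rcases single_add_single_eq_iff.1 hsum with ⟨rfl, rfl⟩ | ⟨rfl, rfl⟩
        · exact hxx (add_right_cancel hi).symm
        · exact hyy hi.symm
      by_cases h₁ : (upEdges x ∩ downEdges (x' + Pi.single a' 1)).Nonempty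
      · obtain ⟨e₁, he₁⟩ := h₁
        have hempty : downEdges (x + Pi.single a 1) ∩ upEdges x' = ∅ :=
          Finset.eq_empty_of_forall_notMem fun e₂ he₂ => hnotboth e₁ he₁ e₂ he₂
        obtain ⟨i, hi⟩ := exists_eq_add_single_of_mem_inter he₁
        have hS : IsS2 (x' + Pi.single a' 1 - (x + Pi.single a 1)) := by
          rw [hi]
          have hia : i ≠ a := by
            rintro rfl
            exact hyy hi.symm
          exact ⟨i, a, hia, by abel⟩
        rw [if_pos hS, hempty, Finset.union_empty]
        calc (upEdges x ∩ downEdges (x' + Pi.single a' 1)).card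
            ≤ ({s(x, x' + Pi.single a' 1)} : Finset _).card :=
              Finset.card_le_card (upEdges_inter_downEdges_subset _ _)
          _ = (d - 1) * 0 + d * 0 + 1 := by simp
      · rw [Finset.not_nonempty_iff_eq_empty] at h₁
        rw [h₁, Finset.empty_union]
        by_cases h₂ : (downEdges (x + Pi.single a 1) ∩ upEdges x').Nonempty
        · obtain ⟨e₂, he₂⟩ := h₂
          rw [Finset.inter_comm] at he₂
          obtain ⟨j, hj⟩ := exists_eq_add_single_of_mem_inter he₂
          have hS : IsS2 (x' + Pi.single a' 1 - (x + Pi.single a 1)) := by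
            rw [hj]
            have hja : a' ≠ j := by
              rintro rfl
              exact hyy hj
            exact ⟨a', j, hja, by abel⟩
          rw [if_pos hS]
          calc (downEdges (x + Pi.single a 1) ∩ upEdges x').card
              ≤ ({s(x', x + Pi.single a 1)} : Finset _).card := by
                rw [Finset.inter_comm]
                exact Finset.card_le_card (upEdges_inter_downEdges_subset _ _)
            _ = (d - 1) * 0 + d * 0 + 1 := by simp
        · rw [Finset.not_nonempty_iff_eq_empty] at h₂
          rw [h₂, Finset.card_empty]
          exact Nat.zero_le _

/-- `1[x_k = x'_k]`. [cite: BockEtAl2020, §3 (`Z_n`)] -/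
def zInd (w w' : Fin n → Fin d) (k : ℕ) : ℕ := if opos w k = opos w' k then 1 else 0

/-- `1[‖x_k - x'_k‖₁ = 2]`. [cite: BockEtAl2020, §3 (`O_n`)] -/
def oInd (w w' : Fin n → Fin d) (k : ℕ) : ℕ := if IsS2 (opos w' k - opos w k) then 1 else 0

/-- `#Z_n(γ, γ') = #{1 ≤ k ≤ n : x_k = x'_k}`. [cite: BockEtAl2020, §3 (`Z_n`)] -/
def zCount (w w' : Fin n → Fin d) : ℕ :=
  ((univ : Finset (Fin n)).filter fun k : Fin n => opos w ((k : ℕ) + 1) = opos w' ((k : ℕ) + 1)).card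

/-- `#O_n(γ, γ') = #{1 ≤ k ≤ n : ‖x_k - x'_k‖₁ = 2}`. [cite: BockEtAl2020, §3 (`O_n`)] -/
def oCount (w w' : Fin n → Fin d) : ℕ :=
  ((univ : Finset (Fin n)).filter fun k : Fin n =>
    IsS2 (opos w' ((k : ℕ) + 1) - opos w ((k : ℕ) + 1))).card

/-- Indicators are at most `1`. [folklore] -/
theorem zInd_le_one (w w' : Fin n → Fin d) (k : ℕ) : zInd w w' k ≤ 1 := by
  unfold zInd; split_ifs <;> norm_num

/-- `x_0 = x'_0 = 0`. [folklore] -/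
theorem zInd_zero (w w' : Fin n → Fin d) : zInd w w' 0 = 1 := by
  simp [zInd]

/-- `#Z_n = Σ_{m<n} 1[x_{m+1} = x'_{m+1}]`. [folklore] -/
theorem zCount_eq_sum (w w' : Fin n → Fin d) :
    zCount w w' = ∑ m ∈ range n, zInd w w' (m + 1) := by
  rw [zCount, Finset.card_filter, ← Fin.sum_univ_eq_sum_range (fun m => zInd w w' (m + 1))]
  simp only [zInd]

/-- `#O_n = Σ_{m<n} 1[‖x_{m+1} - x'_{m+1}‖₁ = 2]`. [folklore] -/
theorem oCount_eq_sum (w w' : Fin n → Fin d) :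
    oCount w w' = ∑ m ∈ range n, oInd w w' (m + 1) := by
  rw [oCount, Finset.card_filter, ← Fin.sum_univ_eq_sum_range (fun m => oInd w w' (m + 1))]
  simp only [oInd]

/-- The layer-by-layer bound along two paths. [cite: BockEtAl2020, §3 (3.6)–(3.7)] -/
theorem card_layer_inter_le (w w' : Fin n → Fin d) {m : ℕ} (hm : m < n) :
    (layer w m ∩ layer w' m).card ≤
      (d - 1) * zInd w w' m + d * zInd w w' (m + 1) + oInd w w' (m + 1) := by
  simp only [zInd, oInd, layer]
  rw [opos_succ w hm, opos_succ w' hm]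
  exact card_cross_le _ _ _ _

/-- Common edges lie in common pieces. [folklore] -/
theorem adjEdges_inter_subset (w w' : Fin n → Fin d) :
    adjEdges w ∩ adjEdges w' ⊆ (range (n + 1 + 1)).biUnion fun t => adjPiece w t ∩ adjPiece w' t := by
  intro e he
  rw [Finset.mem_inter, adjEdges, adjEdges, Finset.mem_biUnion, Finset.mem_biUnion] at he
  obtain ⟨⟨t, ht, het⟩, ⟨t', ht', het'⟩⟩ := he
  rw [Finset.mem_range] at ht ht'
  have h1 := lowLevel_of_mem_piece w (by omega) het
  have h2 := lowLevel_of_mem_piece w' (by omega) het'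
  have htt : t = t' := by omega
  subst htt
  exact Finset.mem_biUnion.2 ⟨t, Finset.mem_range.2 ht, Finset.mem_inter.2 ⟨het, het'⟩⟩

/-- **BDNS (3.4)**: `#(𝓔(γ) ∩ 𝓔(γ')) ≤ 2d + (2d - 1) #Z_n(γ,γ') + #O_n(γ,γ')`.
[cite: BockEtAl2020, §3 (3.4)] -/
theorem card_adjEdges_inter_le (w w' : Fin n → Fin d) :
    (adjEdges w ∩ adjEdges w').card ≤ 2 * d + (2 * d - 1) * zCount w w' + oCount w w' := by
  rcases Nat.eq_zero_or_pos d with hd0 | hdpos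
  · -- `d = 0`: there are no edges at all
    subst hd0
    calc (adjEdges w ∩ adjEdges w').card ≤ (adjEdges w).card :=
          Finset.card_le_card Finset.inter_subset_left
      _ = 2 * 0 + n * (2 * 0 - 1) := card_adjEdges w
      _ ≤ _ := by simp
  obtain ⟨d', rfl⟩ : ∃ d', d = d' + 1 := ⟨d - 1, by omega⟩
  -- sum of the piecewise intersections
  have h1 : (adjEdges w ∩ adjEdges w').card ≤
      ∑ t ∈ range (n + 1 + 1), (adjPiece w t ∩ adjPiece w' t).card :=
    (Finset.card_le_card (adjEdges_inter_subset w w')).trans Finset.card_biUnion_le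
  -- the bottom adjPiece, the layers, the top adjPiece
  have hbot : (adjPiece w 0 ∩ adjPiece w' 0).card = d' + 1 := by
    rw [adjPiece, adjPiece, if_pos rfl, if_pos rfl, Finset.inter_self, card_downEdges]
  have htop : (adjPiece w (n + 1) ∩ adjPiece w' (n + 1)).card ≤ (d' + 1) * zInd w w' n := by
    rw [adjPiece, adjPiece, if_neg (Nat.succ_ne_zero n), if_neg (by omega), if_neg (Nat.succ_ne_zero n),
      if_neg (by omega), zInd]
    split_ifs with h
    · rw [h, Finset.inter_self, card_upEdges, mul_one]
    · rw [upEdges_inter_upEdges_eq_empty h, Finset.card_empty]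
      exact Nat.zero_le _
  have hmid : ∀ t ∈ range n, (adjPiece w (t + 1) ∩ adjPiece w' (t + 1)).card ≤
      d' * zInd w w' t + (d' + 1) * zInd w w' (t + 1) + oInd w w' (t + 1) := by
    intro t ht
    rw [Finset.mem_range] at ht
    rw [adjPiece, adjPiece, if_neg (Nat.succ_ne_zero t), if_pos (by omega), if_neg (Nat.succ_ne_zero t),
      if_pos (by omega), Nat.add_sub_cancel]
    have := card_layer_inter_le w w' ht
    rwa [Nat.add_sub_cancel] at this
  have h2 : ∑ t ∈ range (n + 1 + 1), (adjPiece w t ∩ adjPiece w' t).card ≤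
      (d' + 1) + ∑ t ∈ range n, (d' * zInd w w' t + (d' + 1) * zInd w w' (t + 1) + oInd w w' (t + 1)) +
        (d' + 1) * zInd w w' n := by
    rw [Finset.sum_range_succ, Finset.sum_range_succ', hbot]
    have := Finset.sum_le_sum hmid
    omega
  rw [Finset.sum_add_distrib, Finset.sum_add_distrib, ← Finset.mul_sum, ← Finset.mul_sum,
    ← zCount_eq_sum, ← oCount_eq_sum] at h2
  -- bookkeeping: `Σ_{t<n} zInd t + zInd n = 1 + zCount`
  have hshift : ∑ t ∈ range n, zInd w w' t + zInd w w' n = 1 + zCount w w' := by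
    have e1 := Finset.sum_range_succ (fun t => zInd w w' t) n
    have e2 := Finset.sum_range_succ' (fun t => zInd w w' t) n
    have h0 := zInd_zero w w'
    rw [zCount_eq_sum]
    omega
  have hmul : d' * ∑ t ∈ range n, zInd w w' t + d' * zInd w w' n = d' + d' * zCount w w' := by
    rw [← mul_add, hshift, mul_add, mul_one]
  have hzn := zInd_le_one w w' n
  have h3 : 2 * (d' + 1) - 1 = d' + (d' + 1) := by omega
  rw [h3, add_mul, add_one_mul]
  rw [add_one_mul, add_one_mul] at h2
  omega

end Literature.Probability.Percolation
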